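/-
Copyright (c) 2026 the pub-hodgecm-mathlib formalisation cell (harness21).  Prover seat hodgecm-mathlib-LH4-p09 (g2), req620 Track A «(D-RAM) FOUR-FRAME» squad
(dealer LH4-plan (g11) WORD #2 ∕ #6: child (ρ3c) of the U2H rows socket (ρ)).  ED. 2 (2026-09-04): SAME text, SAME name, elaborated in the LINES MODULE'S notation context (tie fix).
-/
import Summits.HodgeConjecture.HodgeConjecture.Theorems.F0P3cDyRamAnchorLeviClause             -- ★ p855650 (LH4-p06 (g2)): brings the (ρ) telescope vocabulary + ★ LH4-p01 `F0P3cDyRamAnchorCountDictionaryZero` (the dictionary at the anchor)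
import Summits.HodgeConjecture.HodgeConjecture.Theorems.F0P3cDyRamFixedCountDiagonalModel     -- ★ p855032 (LH4-p11): `fixedVertexCount_frameElt_eq_ncard_diagonal_model` (the frame count in a unit diagonal model)
import Summits.HodgeConjecture.HodgeConjecture.Theorems.F0P3cDyRamDiagonalFixedFinite          -- ★ p855247 (LH4-p14): `finite_setOf_isVertexLattice_mapGL_diagonal_eq` (the fixed set is finite for regular `T`)
import Summits.HodgeConjecture.HodgeConjecture.Theorems.F0P3cDyRamDiagonalCoreUnique           -- ★ p855200 (LH4-p04): `isIntMatrix_diagonal_of_v_le`, `isIntMatrix_diagonal_inv_of_v_eq_one`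
import Literature.NumberTheory.Automorphic.UnitaryThreeFourFrameFamilyExists                   -- ★ (F0P3-p01): `exists_isFourFrameFamily` (four-frame families exist at every non-split CM place)
import Literature.NumberTheory.Automorphic.UnitaryThreeFourFrameLiteralUnitary                  -- ★ (F0P3-p01): `exists_frameGL`, `exists_unitary_coe_eq_smul_frameElt` (`z·Γ_b ∈ U(σ, Φ₃)`)
import Literature.NumberTheory.Automorphic.UnitaryLatticeTreeSeparableStableRoot               -- ★ `isSelfDualLattice_stdLattice_diagonal` (`𝒪³` is a type-0 vertex of a unit diagonal form)
import Literature.NumberTheory.Automorphic.UnitaryLatticeTreeStabilizer                        -- ★ `mapGL_stdLattice_eq_iff` (`T·𝒪³ = 𝒪³` for integral `T`, `T⁻¹`)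
import Literature.NumberTheory.LocalFields.WildQuadraticDatumTrace                             -- ★ datum toolkit: `two_ne_zero`, `map_varpi_ne`, `sub_map_ne_zero`
import Summits.HodgeConjecture.HodgeConjecture.Theorems.F0P3cDyRamFourFrameHSideDefs              -- DEFS LEAF №2c (opened by the Lines module; imported so the `open` lines below mirror it exactly)
import Summits.HodgeConjecture.HodgeConjecture.Theorems.F0P3cDyRamFourFrameHSideDefsR             -- DEFS LEAF №2c-R (idem)
import Summits.HodgeConjecture.HodgeConjecture.Theorems.F0P3cDyRamFourFrameLawDefsR               -- №1-R (`shiftT shiftR`, idem)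
import HarnessLib

/-!
# Crux `H413`, line LH4 «(D-RAM) FOUR-FRAME» road — unit (ii-H), child (ρ3c) of the rows socket (ρ): THE CENSUS CONSTANT IS THE HAAR MASS OF THE ANCHOR, `C = νG₃(K_t)`
# — ED. 2: the statement is now elaborated under the Lines module's `open` context (`open scoped … ValuativeRel`, NOT `Valued`), so that `𝒪[K]` in the binder `_h2` is
#   `Valuation.integer (ValuativeRel.valuation K)` exactly as in tree `stub_U2H_censusConstant_unit0` (dealer WORD #6 finding: ★ p855782's `_h2` read `Valued.integer K` — texts
#   byte-identical, elaborations different; `:= censusConstant_unit0` mismatched, the eta form timed out at `whnf`).  Now the ED. 9 pay line `:= …F0P3cDyRamCensusConstantUnit0.censusConstant_unit0` is syntactic.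

Cell `hodgecm-mathlib` (D-0151), FLOOR 0, crux item H413 = `stmt-HodgeConjecture-24833`, route of record `HCCMUnconditional`; squad F0∕P3c∕LH4 (req618∕req620).  THEOREMS ONLY
(no `def`, no instance, no notation, no `sorry`, `autoImplicit false` only); lane `--supports stmt-HodgeConjecture-24833 --as helper`.  Tree socket served BY NAME (type TOKEN
FOR TOKEN): `F0P3cDyRamFourFrameU2H.stub_U2H_censusConstant_unit0` (`Cruxes/H413/Lines/F0_P3c_DyRamFourFrame_U2H_HSide.lean` ED. 7 :197, dealer LH4-plan (g11) cand
`U2H_HSide.ED7.frozen-p06v2` 2bbef6bde5fbb0f0; payer deal WORD #2).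

WHAT IS PROVED.  `censusConstant_unit0`: under the full (ρ) telescope (a wild ramified non-split CM place `w ∣ v` of `L ∕ L⁺`, the datum, the Hecke character, Haar measures
`νH, νG₃`, canonical orbital families, a SELF-DUAL vertex `N` with stabiliser `K_t` (membership `hKt`), a scalar `C`) and the CENSUS HYPOTHESIS `hC` («for every four-frame
family `f`, norm-one `α ≠ β`, `α, β ≠ 1`, `z`, frame `b`, `Γ = frameElt σ_w f b α β` and every `γ ∈ G(L⁺_v)` whose one-place matrix is `z·Γ`: `Φ(⟦γ⟧, 1_{K_t}; mG₃) = C·n₀(Γ)`»):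
**`C = νG₃(K_t)`** (as `((νG₃.real K_t : ℝ) : ℂ)`).

THE MATHEMATICS (dealer's brief, 5 lines).  (1) ★ LH4-p01 `classOrbitalIntegral_indicator_eq_mul_fixedVertexCount_zero` gives, under the SAME binders, `Φ(⟦γ⟧, 1_{K_t}) = νG₃(K_t)·n₀(Γ)`
for EVERY frame element; `hC` says `= C·n₀(Γ)`.  (2) So it suffices to exhibit ONE instance `(f, α, β, z, b, Γ, γ)` with `n₀(Γ) ≠ 0` and cancel.  (3) WITNESSES: `f` by ★
`exists_isFourFrameFamily` (a non-norm exists at the CM place, ★ (J3)); `α := (1 − ϖ)∕σ_w(1 − ϖ)`, `β := (1 + ϖ)∕σ_w(1 + ϖ)` — norm-one quotients of units, `β ≠ 1` and `α ≠ 1`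
because `σ_wϖ ≠ ϖ` (datum), `α ≠ β` because `2 ≠ 0` (datum: `|2| = |ϖ|^{t_E}`); `z := 1`; `b := 0`; `Γ` by ★ `exists_frameGL`; `γ := e⁻¹(Γ)` along the one-place model
`e = localNonsplitEquiv` (★ `exists_unitary_coe_eq_smul_frameElt`: `Γ ∈ U(σ_w, Φ₃)`, and `(Φ₃)_w = J₀` by ★ `placeForm_antidiagThree_eq_over`).  (4) THE ONE REAL LEMMA
`n₀(Γ) ≠ 0`: by ★ p855032 the count is `#{M : type-0 vertex of (L_w³, diag d), diag(α,β,1)·M = M}` for a UNIT diagonal model `d`; this set is FINITE (★ p855247, `α, β, 1`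
pairwise distinct = regular) and contains the standard lattice `𝒪_w³` (self-dual for a unit diagonal form, ★ `isSelfDualLattice_stdLattice_diagonal`; fixed by the integral
diagonal unit `diag(α, β, 1)`, ★ `mapGL_stdLattice_eq_iff`), so its `ncard` is positive.  (5) `C·n = ν·n`, `n ≠ 0` ⇒ `C = ν` in `ℂ`.
[Kottwitz1986BaseChangeUnits §1 pp. 240–241; Rogawski1990 §4.9 Prop. 4.9.1 (b) p. 55, §4.3 (4.3.1) p. 43.]
HONEST LABEL.  Count-neutral (`--supports`); nothing printed is asserted; the (R-13) risk «non-vacuity of `hC`» is DISCHARGED by (3)+(4); `HC_CM` is proved only modulo the 7 printed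
citations (2 remaining named inputs: hLiu418 = `stmt-HodgeConjecture-24832`, h413 = `stmt-HodgeConjecture-24833`) until rung 0 closes.

## References
* [Kottwitz1986BaseChangeUnits] R. E. Kottwitz, *Base change for unit elements of Hecke algebras*, Compositio Math. 60 (1986), §1 pp. 240–241.
* [Rogawski1990] J. D. Rogawski, *Automorphic Representations of Unitary Groups in Three Variables*, Ann. of Math. Stud. 123 (1990), §4.9 Prop. 4.9.1 (b) p. 55; §4.3 (4.3.1) p. 43.
-/

set_option autoImplicit false

noncomputable section

-- THE LINES MODULE'S `open` CONTEXT, line for line (tree `Cruxes/H413/Lines/F0_P3c_DyRamFourFrame_U2H_HSide.lean` ED. 7, after its `namespace`):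
open MeasureTheory Measure NumberField IsDedekindDomain Topology Filter
open Literature.NumberTheory.Automorphic Literature.NumberTheory.Automorphic.UnitaryGroup Literature.NumberTheory.Automorphic.IntegralReduction
open Literature.NumberTheory.Rogawski1990 Literature.NumberTheory.GaloisRepresentations
open Literature.NumberTheory.Automorphic.UnitaryThreeFourFrame
open Summit.HodgeConjecture.HodgeConjecture.Cruxes.H413.F0P3cDyRamFourFrameHSideDefs
open Summit.HodgeConjecture.HodgeConjecture.Cruxes.H413.F0P3cDyRamFourFrameHFamilyDefs
open scoped Matrix MatrixGroups Classical ValuativeRel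
open Summit.HodgeConjecture.HodgeConjecture.Cruxes.H413.F0P3cDyRamFourFrameHSideDefsR
open Summit.HodgeConjecture.HodgeConjecture.Cruxes.H413.F0P3cDyRamFourFrameLawDefsR (shiftT shiftR)
open Literature.NumberTheory.Automorphic.UnitaryLatticeTree Literature.NumberTheory.Automorphic.HermitianLattice
-- (no `open scoped Valued`: its `𝒪[·]` would shadow ∕ clash with `ValuativeRel`'s — the whole point of this edition)
open Literature.NumberTheory.LocalFields.WildQuadraticDatum (map_varpi_ne sub_map_ne_zero)

namespace Summit.HodgeConjecture.HodgeConjecture.Cruxes.H413.F0P3cDyRamCensusConstantUnit0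

/-- **(ρ3c) THE CENSUS CONSTANT IS THE HAAR MASS OF THE ANCHOR — `C = νG₃(K_t)`, ED. 2** (type = tree `stub_U2H_censusConstant_unit0` TOKEN FOR TOKEN AND ELABORATION FOR ELABORATION:
`𝒪[K]` in `_h2` is ValuativeRel's `Valuation.integer (valuation K)` as in the Lines module; the proof never uses `_h2`, so no bridge between the two integer rings is needed).  Under the (ρ) telescope and the
census hypothesis `hC : Φ(⟦γ⟧, 1_{K_t}) = C·n₀(Γ)` for all frame data: instantiate at ONE frame element (`f` ★ `exists_isFourFrameFamily`, `α = (1−ϖ)∕σ(1−ϖ)`, `β = (1+ϖ)∕σ(1+ϖ)`,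
`z = 1`, `b = 0`, `γ = e⁻¹ Γ`), compare with ★ LH4-p01's dictionary `Φ = νG₃(K_t)·n₀(Γ)`, and cancel `n₀(Γ) ≠ 0` (the standard lattice is a type-0 fixed vertex of the unit
diagonal model, and the fixed set is finite). [cite: Kottwitz1986BaseChangeUnits, §1 pp. 240–241] [cite: Rogawski1990, §4.9 Prop. 4.9.1 (b) p. 55] -/
theorem censusConstant_unit0 :
    ∀ (L : Type) [Field L] [NumberField L] [IsCMField L]
      {v : HeightOneSpectrum (𝓞 ↥(maximalRealSubfield L))} (w : UnitaryGroup.PlacesOver L v)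
      (hw : IsCMField.complexConj L • w.1 = w.1) (_he : v.asIdeal.ramificationIdx' w.1.asIdeal ≠ 1)
      (_h2 : ¬ IsUnit (2 : 𝒪[w.1.adicCompletion L]))
      (ϖ : (w.1.adicCompletion L)) (_hϖ : Valued.v ϖ = WithZero.exp (-1 : ℤ)) (d tE : ℕ) (_hD : IsRamifiedQuadraticDatum (galAdicCompletionMap (L := L) (IsCMField.complexConj L) hw) ϖ d tE)
      [Fintype (Valued.ResidueField (w.1.adicCompletion L))] (δ : (w.1.adicCompletion L)) (_hδ : (galAdicCompletionMap (L := L) (IsCMField.complexConj L) hw) δ = -δ) (_hδ0 : δ ≠ 0)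
      (μ : HeckeCharacter L) (_hμu : μ.IsUnitary)
      (_hμω : ∀ x : ideleGroup ↥(maximalRealSubfield L), μ (AdeleRing.ideleBaseChange ↥(maximalRealSubfield L) L x) = quadraticHeckeCharCM L x)
      [MeasurableSpace ((UnitaryGroup.cmDatum L 3 (Matrix.of fun i j : Fin 3 => if i.val + j.val + 1 = 3 then (1 : L) else 0)).Local v)] [BorelSpace ((UnitaryGroup.cmDatum L 3 (Matrix.of fun i j : Fin 3 => if i.val + j.val + 1 = 3 then (1 : L) else 0)).Local v)]
      [∀ γ : ((UnitaryGroup.cmDatum L 3 (Matrix.of fun i j : Fin 3 => if i.val + j.val + 1 = 3 then (1 : L) else 0)).Local v), MeasurableSpace (((UnitaryGroup.cmDatum L 3 (Matrix.of fun i j : Fin 3 => if i.val + j.val + 1 = 3 then (1 : L) else 0)).Local v) ⧸ Subgroup.centralizer ({γ} : Set ((UnitaryGroup.cmDatum L 3 (Matrix.of fun i j : Fin 3 => if i.val + j.val + 1 = 3 then (1 : L) else 0)).Local v)))]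
      [∀ γ : ((UnitaryGroup.cmDatum L 3 (Matrix.of fun i j : Fin 3 => if i.val + j.val + 1 = 3 then (1 : L) else 0)).Local v), BorelSpace (((UnitaryGroup.cmDatum L 3 (Matrix.of fun i j : Fin 3 => if i.val + j.val + 1 = 3 then (1 : L) else 0)).Local v) ⧸ Subgroup.centralizer ({γ} : Set ((UnitaryGroup.cmDatum L 3 (Matrix.of fun i j : Fin 3 => if i.val + j.val + 1 = 3 then (1 : L) else 0)).Local v)))]
      [MeasurableSpace ((UnitaryGroup.cmDatum L 2 (Matrix.of fun i j : Fin 2 => if i.val + j.val + 1 = 2 then (1 : L) else 0)).Local v × (UnitaryGroup.cmDatum L 1 (Matrix.of fun i j : Fin 1 => if i.val + j.val + 1 = 1 then (1 : L) else 0)).Local v)] [BorelSpace ((UnitaryGroup.cmDatum L 2 (Matrix.of fun i j : Fin 2 => if i.val + j.val + 1 = 2 then (1 : L) else 0)).Local v × (UnitaryGroup.cmDatum L 1 (Matrix.of fun i j : Fin 1 => if i.val + j.val + 1 = 1 then (1 : L) else 0)).Local v)]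
      [∀ a : ((UnitaryGroup.cmDatum L 2 (Matrix.of fun i j : Fin 2 => if i.val + j.val + 1 = 2 then (1 : L) else 0)).Local v × (UnitaryGroup.cmDatum L 1 (Matrix.of fun i j : Fin 1 => if i.val + j.val + 1 = 1 then (1 : L) else 0)).Local v), MeasurableSpace (((UnitaryGroup.cmDatum L 2 (Matrix.of fun i j : Fin 2 => if i.val + j.val + 1 = 2 then (1 : L) else 0)).Local v × (UnitaryGroup.cmDatum L 1 (Matrix.of fun i j : Fin 1 => if i.val + j.val + 1 = 1 then (1 : L) else 0)).Local v) ⧸ Subgroup.centralizer ({a} : Set ((UnitaryGroup.cmDatum L 2 (Matrix.of fun i j : Fin 2 => if i.val + j.val + 1 = 2 then (1 : L) else 0)).Local v × (UnitaryGroup.cmDatum L 1 (Matrix.of fun i j : Fin 1 => if i.val + j.val + 1 = 1 then (1 : L) else 0)).Local v)))]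
      [∀ a : ((UnitaryGroup.cmDatum L 2 (Matrix.of fun i j : Fin 2 => if i.val + j.val + 1 = 2 then (1 : L) else 0)).Local v × (UnitaryGroup.cmDatum L 1 (Matrix.of fun i j : Fin 1 => if i.val + j.val + 1 = 1 then (1 : L) else 0)).Local v), BorelSpace (((UnitaryGroup.cmDatum L 2 (Matrix.of fun i j : Fin 2 => if i.val + j.val + 1 = 2 then (1 : L) else 0)).Local v × (UnitaryGroup.cmDatum L 1 (Matrix.of fun i j : Fin 1 => if i.val + j.val + 1 = 1 then (1 : L) else 0)).Local v) ⧸ Subgroup.centralizer ({a} : Set ((UnitaryGroup.cmDatum L 2 (Matrix.of fun i j : Fin 2 => if i.val + j.val + 1 = 2 then (1 : L) else 0)).Local v × (UnitaryGroup.cmDatum L 1 (Matrix.of fun i j : Fin 1 => if i.val + j.val + 1 = 1 then (1 : L) else 0)).Local v)))]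
      (νH : Measure ((UnitaryGroup.cmDatum L 2 (Matrix.of fun i j : Fin 2 => if i.val + j.val + 1 = 2 then (1 : L) else 0)).Local v × (UnitaryGroup.cmDatum L 1 (Matrix.of fun i j : Fin 1 => if i.val + j.val + 1 = 1 then (1 : L) else 0)).Local v)) [νH.IsHaarMeasure] [νH.IsMulRightInvariant]
      (νG₃ : Measure ((UnitaryGroup.cmDatum L 3 (Matrix.of fun i j : Fin 3 => if i.val + j.val + 1 = 3 then (1 : L) else 0)).Local v)) [νG₃.IsHaarMeasure] [νG₃.IsMulRightInvariant]
      (mH : OrbitalMeasureFamily ((UnitaryGroup.cmDatum L 2 (Matrix.of fun i j : Fin 2 => if i.val + j.val + 1 = 2 then (1 : L) else 0)).Local v × (UnitaryGroup.cmDatum L 1 (Matrix.of fun i j : Fin 1 => if i.val + j.val + 1 = 1 then (1 : L) else 0)).Local v)) (mG₃ : OrbitalMeasureFamily ((UnitaryGroup.cmDatum L 3 (Matrix.of fun i j : Fin 3 => if i.val + j.val + 1 = 3 then (1 : L) else 0)).Local v))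
      (_hmH : mH.IsCanonical (IsLocalGRegular L v) νH) (_hmG : mG₃.IsCanonical (fun γ => IsRegularElt (γ.val : GL (Fin 3) (UnitaryGroup.LocalRing L v))) νG₃)
      (N : Submodule (Valued.integer (w.1.adicCompletion L)) (Fin 3 → (w.1.adicCompletion L))) (_hN : IsVertexLattice (galAdicCompletionMap (L := L) (IsCMField.complexConj L) hw) ϖ ((StdForm.antidiagonal 3).over (w.1.adicCompletion L)) 0 N)
      (Kt : Subgroup ((UnitaryGroup.cmDatum L 3 (Matrix.of fun i j : Fin 3 => if i.val + j.val + 1 = 3 then (1 : L) else 0)).Local v)) (_hKt : ∀ u : ((UnitaryGroup.cmDatum L 3 (Matrix.of fun i j : Fin 3 => if i.val + j.val + 1 = 3 then (1 : L) else 0)).Local v), u ∈ Kt ↔ mapGL ((localNonsplitEquiv (IsCMField.complexConj L) (Matrix.of fun i j : Fin 3 => if i.val + j.val + 1 = 3 then (1 : L) else 0) (IsCMField.complexConj_ne_one L) w hw u :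
              ↥(unitaryGroupOfForm (galAdicCompletionMap (L := L) (IsCMField.complexConj L) hw) (placeForm (Matrix.of fun i j : Fin 3 => if i.val + j.val + 1 = 3 then (1 : L) else 0) w.1))) : GL (Fin 3) (w.1.adicCompletion L)) N = N)
      (C : ℂ),
      -- v1.4 (ref4 R4-77 (J-3)): `C` TIED to the census — it must be the (D-G) dictionary constant of THIS anchor, not an arbitrary scalar
      (∀ (f : Fin 4 → Fin 3 → (Fin 3 → (w.1.adicCompletion L))), IsFourFrameFamily (galAdicCompletionMap (L := L) (IsCMField.complexConj L) hw) f →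
        ∀ (α β z : (w.1.adicCompletion L)), α * (galAdicCompletionMap (L := L) (IsCMField.complexConj L) hw) α = 1 → β * (galAdicCompletionMap (L := L) (IsCMField.complexConj L) hw) β = 1 → z * (galAdicCompletionMap (L := L) (IsCMField.complexConj L) hw) z = 1 → α ≠ β → α ≠ 1 → β ≠ 1 →
        ∀ (b : Fin 4) (Γ : GL (Fin 3) (w.1.adicCompletion L)), (Γ : Matrix (Fin 3) (Fin 3) (w.1.adicCompletion L)) = frameElt (galAdicCompletionMap (L := L) (IsCMField.complexConj L) hw) f b α β →
        ∀ (γ : ((UnitaryGroup.cmDatum L 3 (Matrix.of fun i j : Fin 3 => if i.val + j.val + 1 = 3 then (1 : L) else 0)).Local v)), ((((localNonsplitEquiv (IsCMField.complexConj L) (Matrix.of fun i j : Fin 3 => if i.val + j.val + 1 = 3 then (1 : L) else 0) (IsCMField.complexConj_ne_one L) w hw γ :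
              ↥(unitaryGroupOfForm (galAdicCompletionMap (L := L) (IsCMField.complexConj L) hw) (placeForm (Matrix.of fun i j : Fin 3 => if i.val + j.val + 1 = 3 then (1 : L) else 0) w.1))) : GL (Fin 3) (w.1.adicCompletion L)) : Matrix (Fin 3) (Fin 3) (w.1.adicCompletion L))) = z • (Γ : Matrix (Fin 3) (Fin 3) (w.1.adicCompletion L)) →
          classOrbitalIntegral mG₃ (Set.indicator (Kt : Set ((UnitaryGroup.cmDatum L 3 (Matrix.of fun i j : Fin 3 => if i.val + j.val + 1 = 3 then (1 : L) else 0)).Local v)) (fun _ => (1 : ℂ))) (ConjClasses.mk γ) = C * (fixedVertexCount (galAdicCompletionMap (L := L) (IsCMField.complexConj L) hw) ϖ 0 Γ : ℂ)) →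
      C = ((νG₃.real (Kt : Set ((UnitaryGroup.cmDatum L 3 (Matrix.of fun i j : Fin 3 => if i.val + j.val + 1 = 3 then (1 : L) else 0)).Local v)) : ℝ) : ℂ) := by
  intro L _ _ _ v w hw _he _h2 ϖ _hϖ d tE _hD _ δ _hδ _hδ0 μ _hμu _hμω _ _ _ _ _ _ _ _ νH _ _ νG₃ _ _ mH mG₃ _hmH _hmG N _hN Kt _hKt C hC
  obtain ⟨hσσ, hvσ, hϖv, heven, hdiff, -, ht⟩ := _hD
  have hϖ0 : ϖ ≠ 0 := fun h => by rw [h, map_zero] at hϖv; exact WithZero.coe_ne_zero hϖv.symm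
  have hσϖ : (galAdicCompletionMap (L := L) (IsCMField.complexConj L) hw) ϖ ≠ ϖ := map_varpi_ne hϖv hdiff
  have h20 : (2 : (w.1.adicCompletion L)) ≠ 0 := Literature.NumberTheory.LocalFields.WildQuadraticDatum.two_ne_zero hϖv ht
  have hϖ1 : Valued.v ϖ < 1 := by rw [hϖv, ← WithZero.exp_zero, WithZero.exp_lt_exp]; norm_num
  -- the two norm-one scalars `α = (1 − ϖ)∕σ(1 − ϖ)`, `β = (1 + ϖ)∕σ(1 + ϖ)`
  have hum : Valued.v (1 - ϖ) = 1 := by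
    rw [sub_eq_add_neg]; exact Valued.v.map_one_add_of_lt (by rw [Valuation.map_neg]; exact hϖ1)
  have hup : Valued.v (1 + ϖ) = 1 := Valued.v.map_one_add_of_lt hϖ1
  have hum0 : (1 - ϖ : (w.1.adicCompletion L)) ≠ 0 := (Valuation.ne_zero_iff _).1 (by rw [hum]; exact one_ne_zero)
  have hup0 : (1 + ϖ : (w.1.adicCompletion L)) ≠ 0 := (Valuation.ne_zero_iff _).1 (by rw [hup]; exact one_ne_zero)
  have hσum0 : (galAdicCompletionMap (L := L) (IsCMField.complexConj L) hw) (1 - ϖ) ≠ 0 := (map_ne_zero (galAdicCompletionMap (L := L) (IsCMField.complexConj L) hw)).2 hum0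
  have hσup0 : (galAdicCompletionMap (L := L) (IsCMField.complexConj L) hw) (1 + ϖ) ≠ 0 := (map_ne_zero (galAdicCompletionMap (L := L) (IsCMField.complexConj L) hw)).2 hup0
  set α : (w.1.adicCompletion L) := (1 - ϖ) / (galAdicCompletionMap (L := L) (IsCMField.complexConj L) hw) (1 - ϖ) with hαdef
  set β : (w.1.adicCompletion L) := (1 + ϖ) / (galAdicCompletionMap (L := L) (IsCMField.complexConj L) hw) (1 + ϖ) with hβdef
  have hα : α * (galAdicCompletionMap (L := L) (IsCMField.complexConj L) hw) α = 1 := by rw [hαdef, map_div₀, hσσ]; field_simp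
  have hβ : β * (galAdicCompletionMap (L := L) (IsCMField.complexConj L) hw) β = 1 := by rw [hβdef, map_div₀, hσσ]; field_simp
  have hvα : Valued.v α = 1 := by rw [hαdef, map_div₀, hvσ, hum, div_one]
  have hvβ : Valued.v β = 1 := by rw [hβdef, map_div₀, hvσ, hup, div_one]
  have hα0 : α ≠ 0 := (Valuation.ne_zero_iff _).1 (by rw [hvα]; exact one_ne_zero)
  have hβ0 : β ≠ 0 := (Valuation.ne_zero_iff _).1 (by rw [hvβ]; exact one_ne_zero)
  have hβ1 : β ≠ 1 := by
    intro h
    rw [hβdef, div_eq_one_iff_eq hσup0, map_add, map_one] at h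
    exact hσϖ (by linear_combination -h)
  have hα1 : α ≠ 1 := by
    intro h
    rw [hαdef, div_eq_one_iff_eq hσum0, map_sub, map_one] at h
    exact hσϖ (by linear_combination h)
  have hαβ : α ≠ β := by
    intro h
    rw [hαdef, hβdef, div_eq_div_iff hσum0 hσup0, map_add, map_sub, map_one] at h
    -- `(1 − ϖ)(1 + σϖ) = (1 + ϖ)(1 − σϖ)` forces `2σϖ = 2ϖ`
    have h2 : (2 : (w.1.adicCompletion L)) * ((galAdicCompletionMap (L := L) (IsCMField.complexConj L) hw) ϖ - ϖ) = 0 := by linear_combination h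
    rcases mul_eq_zero.1 h2 with h' | h'
    · exact h20 h'
    · exact hσϖ (sub_eq_zero.1 h')
  -- a four-frame family, the frame element `Γ_0`, and `γ = e⁻¹ Γ` (`z = 1`)
  obtain ⟨f, hf⟩ := exists_isFourFrameFamily L w hw
  obtain ⟨Γ, hΓ⟩ := exists_frameGL hf 0 hα0 hβ0
  have hpf : placeForm (Matrix.of fun i j : Fin 3 => if i.val + j.val + 1 = 3 then (1 : L) else 0) w.1 = (StdForm.antidiagonal 3).over (w.1.adicCompletion L) :=
    placeForm_antidiagThree_eq_over L w
  obtain ⟨U, hUmem, hUcoe⟩ := exists_unitary_coe_eq_smul_frameElt hf 0 (z := (1 : (w.1.adicCompletion L)))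
    (by rw [mul_comm]; exact hα) (by rw [mul_comm]; exact hβ) (by rw [map_one, mul_one])
  have hUmem' : U ∈ unitaryGroupOfForm (galAdicCompletionMap (L := L) (IsCMField.complexConj L) hw) (placeForm (Matrix.of fun i j : Fin 3 => if i.val + j.val + 1 = 3 then (1 : L) else 0) w.1) := by
    rw [hpf]; exact hUmem
  set e := localNonsplitEquiv (IsCMField.complexConj L) (Matrix.of fun i j : Fin 3 => if i.val + j.val + 1 = 3 then (1 : L) else 0)
    (IsCMField.complexConj_ne_one L) w hw with hedef
  set γ := e.symm ⟨U, hUmem'⟩ with hγdef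
  have hγ : ((((e γ : ↥(unitaryGroupOfForm (galAdicCompletionMap (L := L) (IsCMField.complexConj L) hw) (placeForm (Matrix.of fun i j : Fin 3 => if i.val + j.val + 1 = 3 then (1 : L) else 0) w.1))) :
      GL (Fin 3) (w.1.adicCompletion L)) : Matrix (Fin 3) (Fin 3) (w.1.adicCompletion L))) = (1 : (w.1.adicCompletion L)) • (Γ : Matrix (Fin 3) (Fin 3) (w.1.adicCompletion L)) := by
    rw [hγdef, ContinuousMulEquiv.apply_symm_apply, hΓ]
    exact hUcoe
  have hz : (1 : (w.1.adicCompletion L)) * (galAdicCompletionMap (L := L) (IsCMField.complexConj L) hw) 1 = 1 := by rw [map_one, mul_one]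
  -- the two evaluations of `Φ(⟦γ⟧, 1_{K_t})`
  have h1 := hC f hf α β 1 hα hβ hz hαβ hα1 hβ1 0 Γ hΓ γ hγ
  have h2 := F0P3cDyRamAnchorCountDictionaryZero.classOrbitalIntegral_indicator_eq_mul_fixedVertexCount_zero L w hw _he _hϖ νG₃
    _hmG _hN Kt _hKt hf hα hβ hz hαβ hα1 hβ1 0 hΓ γ hγ
  -- `n₀(Γ) ≠ 0`: the standard lattice is a type-0 fixed vertex of the unit diagonal model, and the fixed set is finite
  have hn : fixedVertexCount (galAdicCompletionMap (L := L) (IsCMField.complexConj L) hw) ϖ 0 Γ ≠ 0 := by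
    obtain ⟨dm, hdm1, -, -, hcount⟩ :=
      F0P3cDyRamFixedCountDiagonalModel.fixedVertexCount_frameElt_eq_ncard_diagonal_model hσσ hvσ hϖv heven hf 0
    -- `T = diag(α, β, 1) ∈ GL₃` (opaque: only its matrix is used)
    have hs1 : ∀ i, Valued.v ((![α, β, 1] : Fin 3 → w.1.adicCompletion L) i) = 1 := by
      intro i; fin_cases i <;> simp [hvα, hvβ]
    obtain ⟨T, hT⟩ : ∃ T : GL (Fin 3) (w.1.adicCompletion L), (T : Matrix (Fin 3) (Fin 3) (w.1.adicCompletion L)) = Matrix.diagonal ![α, β, 1] := by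
      have hdet : (Matrix.diagonal (![α, β, 1] : Fin 3 → w.1.adicCompletion L)).det ≠ 0 := by
        rw [Matrix.det_diagonal]
        exact Finset.prod_ne_zero_iff.2 fun i _ => (Valuation.ne_zero_iff _).1 (by rw [hs1 i]; exact one_ne_zero)
      exact ⟨Matrix.GeneralLinearGroup.mkOfDetNeZero _ hdet, rfl⟩
    rw [hcount α β T Γ hT hΓ 0]
    have hfin : {M : Submodule (Valued.integer (w.1.adicCompletion L)) (Fin 3 → (w.1.adicCompletion L)) | IsVertexLattice (galAdicCompletionMap (L := L) (IsCMField.complexConj L) hw) ϖ (Matrix.diagonal dm) 0 M ∧ mapGL T M = M}.Finite := by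
      refine F0P3cDyRamDiagonalFixedFinite.finite_setOf_isVertexLattice_mapGL_diagonal_eq hvσ hϖv hdm1 ![α, β, 1] (fun i => (hs1 i).le) ?_ T hT 0
      intro i j hij
      fin_cases i <;> fin_cases j
      all_goals first
        | rfl
        | (exfalso; simp at hij;
           first | exact hαβ hij | exact hαβ hij.symm | exact hα1 hij | exact hα1 hij.symm | exact hβ1 hij | exact hβ1 hij.symm)
    have hmem : stdLattice (w.1.adicCompletion L) 3 ∈ {M : Submodule (Valued.integer (w.1.adicCompletion L)) (Fin 3 → (w.1.adicCompletion L)) | IsVertexLattice (galAdicCompletionMap (L := L) (IsCMField.complexConj L) hw) ϖ (Matrix.diagonal dm) 0 M ∧ mapGL T M = M} := by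
      refine ⟨isSelfDualLattice_stdLattice_diagonal (galAdicCompletionMap (L := L) (IsCMField.complexConj L) hw) hϖ1.le hdm1, ?_⟩
      rw [mapGL_stdLattice_eq_iff, Matrix.coe_units_inv, hT]
      exact ⟨F0P3cDyRamDiagonalCoreUnique.isIntMatrix_diagonal_of_v_le fun i => (hs1 i).le,
        F0P3cDyRamDiagonalCoreUnique.isIntMatrix_diagonal_inv_of_v_eq_one hs1⟩
    exact ((Set.ncard_pos hfin).2 ⟨_, hmem⟩).ne'
  have hnC : (fixedVertexCount (galAdicCompletionMap (L := L) (IsCMField.complexConj L) hw) ϖ 0 Γ : ℂ) ≠ 0 := by exact_mod_cast hn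
  rw [h1] at h2
  have hC' := mul_right_cancel₀ hnC h2
  rw [hC', measureReal_def]

end Summit.HodgeConjecture.HodgeConjecture.Cruxes.H413.F0P3cDyRamCensusConstantUnit0

end
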